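import Mathlib
import Summits.Ventures.PercRepro2.Defs
import Summits.Ventures.PercRepro2.Graph
import Summits.Ventures.PercRepro2.Events
import Summits.Ventures.PercRepro2.Harris
import Summits.Ventures.PercRepro2.Induced
import Summits.Ventures.PercRepro2.VdBKahn
import Summits.Ventures.PercRepro2.BHK
import Summits.Ventures.PercRepro2.BHKEvents

/-!
# The same-cluster inequality with set avoidance, for events (blind cell PercRepro2, mine-1)

BHK06 Thm 1.3 with a SET `X` avoided by the root `s`, for up-sets `𝓤, 𝓥` of vertex sets:

  `P(C_s ∈ 𝓤, s ↮ X) · P(C_s ∈ 𝓥, s ↮ X) ≤ P(C_s ∈ 𝓤 ∩ 𝓥, s ↮ X) · P(s ↮ X)`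

(`bhk_same_cluster_events_avoid`; `X = {t}` is `bhk_same_cluster_events`): the cluster of `s`
conditioned to avoid `X` is positively associated.  It is `bhk_induced` with `U = univ`, `X = Y`.

Corollary for the (J1) line (`nuPrime_pa`, answering the lead's question whether
`Cov_{ν′}(b ∈ C₂, o ∈ C₂) ≥ 0` under `ν′ = law of C(a₂) given a₂ ↮ a₁, a₂ ↮ a₃` is a theorem):
`P(b ∈ C₂, a₂ ↮ {a₁, a₃}) · P(o ∈ C₂, a₂ ↮ {a₁, a₃}) ≤ P(b, o ∈ C₂, a₂ ↮ {a₁, a₃}) · P(a₂ ↮ {a₁, a₃})`.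
-/

namespace Summit.Ventures.PercRepro2

section SameClusterAvoid

variable {V : Type*} {E : Type*} [Fintype E] [DecidableEq E] [Fintype V] [DecidableEq V]
  {R : Type*} [CommRing R] [LinearOrder R] [IsStrictOrderedRing R]

/-- **BHK, same cluster, set avoidance, for events** (BHK06 Thm 1.3): for up-sets `𝓤, 𝓥`,
`P(C_s ∈ 𝓤, s ↮ X) · P(C_s ∈ 𝓥, s ↮ X) ≤ P(C_s ∈ 𝓤 ∩ 𝓥, s ↮ X) · P(s ↮ X)`. -/
theorem bhk_same_cluster_events_avoid (p : E → R) (hp : IsProbVec p) (ends : E → Sym2 V) (s : V)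
    (X : Finset V) {𝓤 𝓥 : Set (Set V)} (h𝓤 : IsUpperSet 𝓤) (h𝓥 : IsUpperSet 𝓥) :
    prob p (clusterInEvent ends s 𝓤 ∩ avoidAll ends s X) *
        prob p (clusterInEvent ends s 𝓥 ∩ avoidAll ends s X) ≤
      prob p (clusterInEvent ends s (𝓤 ∩ 𝓥) ∩ avoidAll ends s X) * prob p (avoidAll ends s X) := by
  classical
  have hF₁ : Monotone (𝓤.indicator (1 : Set V → R)) := monotone_indicator_one_of_isUpperSet h𝓤
  have hF₂ : Monotone (𝓥.indicator (1 : Set V → R)) := monotone_indicator_one_of_isUpperSet h𝓥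
  have hF₁0 : ∀ W, 0 ≤ 𝓤.indicator (1 : Set V → R) W :=
    fun W => Set.indicator_apply_nonneg fun _ => zero_le_one
  have hF₂0 : ∀ W, 0 ≤ 𝓥.indicator (1 : Set V → R) W :=
    fun W => Set.indicator_apply_nonneg fun _ => zero_le_one
  have key := bhk_induced p hp ends s hF₁ hF₂ hF₁0 hF₂0 Finset.univ X X (Finset.subset_univ _)
    (Finset.subset_univ _)
  simp only [Finset.inter_self, Finset.union_self, REvent_univ] at key
  have e : ∀ F : Set V → R, clusterObs ends Finset.univ s F * (avoidAll ends s X).indicator 1 =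
      fun ω => F (cluster ends ω s) * (avoidAll ends s X).indicator 1 ω := by
    intro F
    funext ω
    simp only [Pi.mul_apply, clusterObs_apply, clusterIn_univ]
  rw [e, e, e] at key
  rw [← prob_clusterInEvent_inter_eq_expect, ← prob_clusterInEvent_inter_eq_expect] at key
  simp only [Pi.mul_apply] at key
  have e3 : (fun ω => 𝓤.indicator (1 : Set V → R) (cluster ends ω s) *
      𝓥.indicator 1 (cluster ends ω s) * (avoidAll ends s X).indicator 1 ω) =
      fun ω => (𝓤 ∩ 𝓥).indicator (1 : Set V → R) (cluster ends ω s) *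
        (avoidAll ends s X).indicator 1 ω := by
    funext ω
    by_cases h1 : cluster ends ω s ∈ 𝓤 <;> by_cases h2 : cluster ends ω s ∈ 𝓥 <;>
      simp [h1, h2]
  rw [e3, ← prob_clusterInEvent_inter_eq_expect] at key
  exact key

/-- **The `{a₃ ∉ C₂}` world is positively associated** (the lead's question of 23:31Z): under
`ν′ = law of C(a₂) given a₂ ↮ a₁, a₂ ↮ a₃`, `Cov_{ν′}(b ∈ C₂, o ∈ C₂) ≥ 0`, multiplied out:
`P(b ∈ C₂, a₂ ↮ {a₁, a₃}) · P(o ∈ C₂, a₂ ↮ {a₁, a₃}) ≤ P(b, o ∈ C₂, a₂ ↮ {a₁, a₃}) · P(a₂ ↮ {a₁, a₃})`. -/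
theorem nuPrime_pa (p : E → R) (hp : IsProbVec p) (ends : E → Sym2 V) (o a₁ a₂ a₃ b : V) :
    prob p (connEvent ends a₂ b ∩ avoidAll ends a₂ {a₁, a₃}) *
        prob p (connEvent ends a₂ o ∩ avoidAll ends a₂ {a₁, a₃}) ≤
      prob p (connEvent ends a₂ b ∩ connEvent ends a₂ o ∩ avoidAll ends a₂ {a₁, a₃}) *
        prob p (avoidAll ends a₂ {a₁, a₃}) := by
  have key := bhk_same_cluster_events_avoid p hp ends a₂ {a₁, a₃}
    (𝓤 := {S : Set V | b ∈ S}) (𝓥 := {S : Set V | o ∈ S}) (fun _ _ h hv => h hv) (fun _ _ h hv => h hv)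
  have e1 : clusterInEvent ends a₂ {S : Set V | b ∈ S} = connEvent ends a₂ b := by
    ext ω; simp [clusterInEvent, connEvent]
  have e2 : clusterInEvent ends a₂ {S : Set V | o ∈ S} = connEvent ends a₂ o := by
    ext ω; simp [clusterInEvent, connEvent]
  have e3 : clusterInEvent ends a₂ ({S : Set V | b ∈ S} ∩ {S : Set V | o ∈ S}) =
      connEvent ends a₂ b ∩ connEvent ends a₂ o := by
    ext ω; simp [clusterInEvent, connEvent]
  rw [e1, e2, e3] at key
  exact key

end SameClusterAvoid

end Summit.Ventures.PercRepro2
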